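import Literature.Topology.FourManifolds.FlowerMelon
import Literature.AlgebraicTopology.FundamentalGroup.MapOfEqRange
import HarnessLib

/-!
# The marking of the flower surface by `S_g`, with the values on the generators

Topic `Literature/Topology/FourManifolds`; companion of `FlowerMelon.lean` (the melon decomposition of the
flower surface `Z_g = {q_g(x, y) + z² = c_g}` into the `g` rotated sectors `secS k = R_k(sectorZ)`
and its marking `flowerSurface_marking : Nonempty (S_g ≃* π₁(Z_g, z))`), written for the
Dehn–Nielsen–Baer seat (`DehnNielsenBaerSurface.lean`): to compute the automorphisms of `π₁(Z_g, 0⁺)` induced by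
explicit self-maps of the flower surface (rotations, reflection, Dehn twists) on the marking, one
needs the VALUES of the marking isomorphism on the generators `a_k, b_k` — which the melon induction
provides (`SurfaceGroupMelon.exists_surfaceGroup_mulEquiv_of_melon_values`) once the sector bases are
taken with explicit values.  Here:

* `FlowerModel.sectorZGenClass hg i` — the class in `π₁(sectorZ, 0⁺)` of the loop
  `γ · loopR i · γ⁻¹` (`FlowerSectorWord`: the arc loops `loopR hg i` at the tip point `P`, read at
  the pole `0⁺` along the path `gam`), and `FlowerModel.secSGenClass hg k i` — its transport to the
  `k`-th slice by the rotation `R_k`;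
* `FlowerModel.exists_basis_sectorZ_bdry_values`, `FlowerModel.exists_basis_secS_values` — the free
  bases of `FlowerSectorWord.exists_basis_sectorZ_bdry` / `FlowerMelon.exists_basis_secS` (boundary
  word `[δ_{k+1} δ_k⁻¹]`) WITH their values `θ_k(a) = secSGenClass k (0, false)`,
  `θ_k(b) = secSGenClass k (0, true)` (same proofs, the values no longer discarded);
* `FlowerModel.flowerSurface_marking_values` — **the marking `μ : S_g ≃* π₁(Z_g, 0⁺)` with
  `μ(a_k) = ι_k(secSGenClass k (0, false))`, `μ(b_k) = ι_k(secSGenClass k (0, true))`**, `ι_k` the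
  inclusion `secS k ⊆ Z_g` on `π₁`;
* `FlowerModel.rotS`, `FlowerModel.mapOfEq_rotS_secSGenClass` — **the rotations `ρ_j` of `Z_g` permute
  these values cyclically**: `(ρ_j)_# (ι_k θ_k(i)) = ι_m θ_m(i)` for `m + j ≡ k (mod g)` (so on the
  marking `(ρ_j)_#` is the cyclic shift `a_k ↦ a_{k-j}`, `b_k ↦ b_{k-j}` of the handles).

Everything is proved; definitions: the named classes, `RkHomeo`, `rotS`; no named facts (D-0026).

## References

* A. Hatcher, *Algebraic Topology* (2002), Thm. 1.20, Example 1.22, §1.2 pp. 50–52.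
  [HatcherAT2002]
* B. Farb, D. Margalit, *A primer on mapping class groups* (2012), Thm. 8.1 (the use: actions of
  mapping classes on `π₁`). [FarbMargalit2012]
-/

open scoped Manifold ContDiff Topology InnerProductSpace Real unitInterval
open Set Function Filter Metric Module Complex

noncomputable section

universe u

namespace Literature.Topology.FourManifolds

/-- Local notation: `𝔼 n` is the model Euclidean space `EuclideanSpace ℝ (Fin n)`. -/
local notation "𝔼 " n:arg => EuclideanSpace ℝ (Fin n)

open PlanarThickening PlanarDouble Literature.AlgebraicTopology.Homotopy
  Literature.AlgebraicTopology.FundamentalGroup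

namespace FlowerModel

variable {g : ℕ}

/-! ### §1 The named generator classes -/

/-- **The generator classes of the standard sector at the pole**: the class in `π₁(sectorZ, 0⁺)` of
`γ · loopR i · γ⁻¹`. [cite: HatcherAT2002, Example 1.22] -/
def sectorZGenClass (hg : 2 ≤ g) (i : surfaceGen 1) :
    FundamentalGroup ↥(sectorZ g) ⟨top g, top_mem_sectorZ hg⟩ :=
  FundamentalGroup.fundamentalGroupMulEquivOfPath
    (VanKampen.liftPath (sectorZ g) (gam hg) (gam_mem hg)).symm
    (FundamentalGroup.fromPath (cl (loopR hg i) (loopR_mem_sectorZ hg i)))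

/-- The rotation `R_k` as a homeomorphism from the standard sector onto the `k`-th slice.
[folklore] -/
def RkHomeo (g k : ℕ) : sectorZ g ≃ₜ secS g k := (Rk g k).image (sectorZ g)

/-- `R_k` fixes the pole (as points of the subtypes). [folklore] -/
theorem RkHomeo_top (hg : 2 ≤ g) (k : ℕ) :
    RkHomeo g k ⟨top g, top_mem_sectorZ hg⟩ = ⟨top g, range_arcK_subset hg k ⟨0, (arcK hg k).source⟩⟩ :=
  Subtype.ext (Rk_top g k)

/-- **The generator classes of the `k`-th slice at the pole**: the transport of `sectorZGenClass`
by the rotation `R_k : sectorZ ≅ secS k` (which fixes the pole). [folklore] -/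
def secSGenClass (hg : 2 ≤ g) (k : ℕ) (i : surfaceGen 1) :
    FundamentalGroup (secS g k) ⟨top g, range_arcK_subset hg k ⟨0, (arcK hg k).source⟩⟩ :=
  fundamentalGroupEquivOfHomeomorph (RkHomeo g k) (RkHomeo_top hg k) (sectorZGenClass hg i)

/-! ### §2 The sector bases with values -/

/-- **The free basis of `π₁(sectorZ, 0⁺)` reading the boundary word, with its values**: as
`exists_basis_sectorZ_bdry`, and `θ(i) = sectorZGenClass i` on the generators.
[cite: HatcherAT2002, Example 1.22 (p. 43), Prop. 1.17] -/
theorem exists_basis_sectorZ_bdry_values (hg : 2 ≤ g) :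
    ∃ θ : FreeGroup (surfaceGen 1) ≃* FundamentalGroup ↥(sectorZ g) ⟨top g, top_mem_sectorZ hg⟩,
      θ (surfaceRelator 1) =
        bdryClass (sectorZ g) (top_mem_sectorZ hg) (vArc hg) (vArcR hg) (vArc_mem_sectorZ hg) (vArcR_mem hg) ∧
      ∀ i, θ (FreeGroup.of i) = sectorZGenClass hg i := by
  obtain ⟨e, he⟩ := exists_basis_loopR hg
  refine ⟨e.trans (FundamentalGroup.fundamentalGroupMulEquivOfPath
    (VanKampen.liftPath (sectorZ g) (gam hg) (gam_mem hg)).symm), ?_, fun i => ?_⟩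
  swap
  · rw [MulEquiv.trans_apply, he]; rfl
  -- the relator as an explicit loop at `P`
  set Wp : Path (⟨ptP g, ptP_mem_sectorZ hg⟩ : ↥(sectorZ g)) ⟨ptP g, ptP_mem_sectorZ hg⟩ :=
    (VanKampen.liftPath (sectorZ g) (loopR hg (0, true)) (loopR_mem_sectorZ hg (0, true))).symm.trans
      ((VanKampen.liftPath (sectorZ g) (loopR hg (0, false)) (loopR_mem_sectorZ hg (0, false))).symm.trans
        ((VanKampen.liftPath (sectorZ g) (loopR hg (0, true)) (loopR_mem_sectorZ hg (0, true))).trans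
          (VanKampen.liftPath (sectorZ g) (loopR hg (0, false)) (loopR_mem_sectorZ hg (0, false))))) with hWp
  have hr : e (surfaceRelator 1) = FundamentalGroup.fromPath (Path.Homotopic.Quotient.mk Wp) := by
    rw [hWp, surfaceRelator_one_eq, map_mul, map_mul, map_mul, map_inv, map_inv, he, he]
    simp only [FundamentalGroup.fromPath, FundamentalGroup.fromArrow, FundamentalGroup.mul_def,
      FundamentalGroup.inv_def, Path.Homotopic.Quotient.mk_trans, Path.Homotopic.Quotient.mk_symm]
  -- `[bigLoop]` split into its pieces (canonical membership proofs)
  have h3 : cl (bigLoop hg) (bigLoop_mem hg) =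
      (cl (gam hg) (gam_mem hg)).symm.trans (((cl (vFourR hg) (vFourR_mem hg)).trans
        (cl (vFourC hg) (vFourC_mem hg)).symm).trans (cl (gam hg) (gam_mem hg))) := by
    rw [cl_symm, cl_symm, cl_trans, cl_trans, cl_trans]
    rfl
  -- the two readings of the relator loop
  have h1 := word_agree hg (loopR_mem_sectorZ hg (0, false)) (loopR_mem_sectorZ hg (0, true))
    (fun t => by rw [Path.cast_coe]; exact emap_mem hg _ _ t)
  have h2 : cl (bigLoop hg) (bigLoop_mem hg) =
      cl ((emap hg (bigLoop hg) (bigLoop_mem hg)).cast (endMap_ptP hg).symm (endMap_ptP hg).symm)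
        (fun t => by rw [Path.cast_coe]; exact emap_mem hg _ _ t) :=
    fromPath_cl_eq_emap hg (bigLoop hg) (bigLoop_mem hg)
  have hW : Path.Homotopic.Quotient.mk Wp =
      (cl (gam hg) (gam_mem hg)).symm.trans (((cl (vFourR hg) (vFourR_mem hg)).trans
        (cl (vFourC hg) (vFourC_mem hg)).symm).trans (cl (gam hg) (gam_mem hg))) := by
    rw [hWp]
    simp only [Path.Homotopic.Quotient.mk_trans, Path.Homotopic.Quotient.mk_symm]
    rw [← h3, h2]
    exact h1
  -- the target loop, split, with the four-piece arcs
  have hT : Path.Homotopic.Quotient.mk (VanKampen.liftPath (sectorZ g) ((vArcR hg).trans (vArc hg).symm)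
      (trans_symm_mem (vArc_mem_sectorZ hg) (vArcR_mem hg))) =
      (cl (vFourR hg) (vFourR_mem hg)).trans (cl (vFourC hg) (vFourC_mem hg)).symm := by
    rw [← cl_vArc_eq, ← cl_vArcR_eq, cl_symm, cl_trans]
  -- assemble
  rw [MulEquiv.trans_apply, hr, VanKampen.fundamentalGroupMulEquivOfPath_fromPath_eq]
  show FundamentalGroup.fromPath _ = FundamentalGroup.fromPath (Path.Homotopic.Quotient.mk
    (VanKampen.liftPath (sectorZ g) ((vArcR hg).trans (vArc hg).symm) (trans_symm_mem (vArc_mem_sectorZ hg) (vArcR_mem hg))))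
  congr 1
  rw [hT, Path.symm_symm, Path.Homotopic.Quotient.mk_trans, Path.Homotopic.Quotient.mk_trans,
    Path.Homotopic.Quotient.mk_symm, hW]
  simp only [Path.Homotopic.Quotient.trans_assoc, VanKampen.trans_symm_cancel, Path.Homotopic.Quotient.trans_symm,
    Path.Homotopic.Quotient.trans_refl]

/-- **The free basis of `π₁(secS k, 0⁺)` reading the boundary word, with its values**: as
`exists_basis_secS`, and `θ_k(i) = secSGenClass k i` on the generators. [cite: HatcherAT2002, Example 1.22] -/
theorem exists_basis_secS_values (hg : 2 ≤ g) (k : ℕ) :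
    ∃ θ : FreeGroup (surfaceGen 1) ≃* FundamentalGroup (secS g k) ⟨top g, range_arcK_subset hg k ⟨0, (arcK hg k).source⟩⟩,
      θ (surfaceRelator 1) = bdryClass (secS g k) (range_arcK_subset hg k ⟨0, (arcK hg k).source⟩) (arcK hg k)
        (arcK hg (k + 1)) (fun t => range_arcK_subset hg k ⟨t, rfl⟩) (fun t => range_arcK_succ_subset hg k ⟨t, rfl⟩) ∧
      ∀ i, θ (FreeGroup.of i) = secSGenClass hg k i := by
  obtain ⟨θ₀, hθ₀, hθ₀v⟩ := exists_basis_sectorZ_bdry_values hg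
  refine ⟨θ₀.trans (fundamentalGroupEquivOfHomeomorph (RkHomeo g k) (RkHomeo_top hg k)), ?_, fun i => ?_⟩
  · rw [MulEquiv.trans_apply, hθ₀, fundamentalGroupEquivOfHomeomorph_apply, _root_.FundamentalGroup.mapOfEq_apply]
    change Path.Homotopic.Quotient.mk _ = Path.Homotopic.Quotient.mk _
    refine congrArg Path.Homotopic.Quotient.mk ?_
    ext t : 2
    apply Subtype.ext
    show Rk g k (((vArcR hg).trans (vArc hg).symm) t) = ((arcK hg (k + 1)).trans (arcK hg k).symm) t
    simp only [Path.trans_apply, Path.symm_apply, arcK_succ_apply]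
    split_ifs <;> rfl
  · rw [MulEquiv.trans_apply, hθ₀v]
    rfl

/-! ### §3 The marking with values -/

/-- **The marking of the flower surface of genus `n + 2` by `S_{n+2}`, with its values on the
generators**: an isomorphism `μ : S_{n+2} ≃* π₁(Z_{n+2}, 0⁺)` sending `a_k`, `b_k` (the generators
`(k, false)`, `(k, true)`) to the images under `secS k ⊆ Z` of the slice generators
`secSGenClass k (0, false)`, `secSGenClass k (0, true)`. [cite: HatcherAT2002, §1.2 pp. 50–52] -/
theorem flowerSurface_marking_values {n : ℕ} (hg : 2 ≤ n + 2) :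
    ∃ (hx : top (n + 2) ∈ flowerSurface (n + 2))
      (hS : ∀ k ≤ n + 1, secS (n + 2) k ⊆ flowerSurface (n + 2))
      (μ : SurfaceGroup (n + 1 + 1) ≃* FundamentalGroup (flowerSurface (n + 2)) ⟨top (n + 2), hx⟩),
      ∀ k (hk : k ≤ n + 1) (c : Bool),
        μ (PresentedGroup.of ((⟨k, Nat.lt_succ_of_le hk⟩ : Fin (n + 1 + 1)), c)) =
          VanKampen.inclHomOfSubset (hS k hk) (top (n + 2)) (range_arcK_subset hg k ⟨0, (arcK hg k).source⟩) hx
            (secSGenClass hg k (0, c)) := by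
  have hint' : ∀ k, 1 ≤ k → k ≤ n →
      (⋃ j ≤ k - 1, secS (n + 2) j) ∩ secS (n + 2) k ⊆ range (arcK hg k) := by
    intro k hk hkn
    rw [iUnion_secS_eq hg (by omega), secS_eq hg, range_arcK, ← inter_inter_distrib_left,
      ← preimage_inter]
    exact inter_subset_inter_right _ (preimage_mono (fanW_inter_secW_subset hg hk (by omega)))
  have hlast' : (⋃ j ≤ n, secS (n + 2) j) ∩ secS (n + 2) (n + 1) ⊆
      range (arcK hg (n + 1)) ∪ range (arcK hg 0) := by
    rw [iUnion_secS_eq hg le_rfl, secS_eq hg, range_arcK, range_arcK, ← inter_inter_distrib_left,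
      ← preimage_inter, ← inter_union_distrib_left, ← preimage_union]
    exact inter_subset_inter_right _ (preimage_mono (fanW_inter_secW_last_subset hg))
  obtain ⟨hxZ, hSZ, μ, hμ⟩ := exists_surfaceGroup_mulEquiv_of_melon_values (n := n) (secS (n + 2))
    (arcK hg) (fun k _ => isClosed_secS hg k) (fun k _ => isPathConnected_secS hg k)
    (fun k _ => range_arcK_subset hg k) (fun k _ => range_arcK_succ_subset hg k) (arcK_period hg)
    hint' (fun k hk hkn => collar_fan hg hk (by omega)) (fun k _ _ => collar_secS hg k)
    (fun k _ _ => isSimplyConnected_range_arcK hg k) hlast' (collar_last_fan hg) (collar_last_secS hg)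
    (injective_arcK hg _) (injective_arcK hg _) (arcK_meet hg)
    (fun k _ => (exists_basis_secS_values hg k).choose)
    (fun k _ => (exists_basis_secS_values hg k).choose_spec.1)
  have hZ := iUnion_secS_eq_flowerSurface hg
  refine ⟨hZ ▸ hxZ, fun k hk => (hSZ k hk).trans hZ.le, ?_⟩
  -- transport along the equality of carriers
  have key : ∀ (W : Set (𝔼 3)) (hW : (⋃ j ≤ n + 1, secS (n + 2) j) = W),
      ∃ μ' : SurfaceGroup (n + 1 + 1) ≃* FundamentalGroup W ⟨top (n + 2), hW ▸ hxZ⟩,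
        ∀ k (hk : k ≤ n + 1) (c : Bool),
          μ' (PresentedGroup.of ((⟨k, Nat.lt_succ_of_le hk⟩ : Fin (n + 1 + 1)), c)) =
            VanKampen.inclHomOfSubset ((hSZ k hk).trans hW.le) (top (n + 2))
              (range_arcK_subset hg k ⟨0, (arcK hg k).source⟩) (hW ▸ hxZ) (secSGenClass hg k (0, c)) := by
    intro W hW
    subst hW
    refine ⟨μ, fun k hk c => ?_⟩
    rw [hμ k hk c, (exists_basis_secS_values hg k).choose_spec.2]
  exact key _ hZ


/-! ### §4 The rotations act on the marking values by the cyclic shift -/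

/-- `ζ_{j+k} = ζ_j ζ_k`. [folklore] -/
theorem ζC_add (j k : ℕ) : ζC g (j + k) = ζC g j * ζC g k := by
  apply Subtype.ext
  simp only [coe_ζC, Circle.coe_mul, pow_add]

/-- `ζ_{gq} = 1`. [folklore] -/
theorem ζC_mul_self (hg : 1 ≤ g) (q : ℕ) : ζC g (g * q) = 1 := by
  induction q with
  | zero => apply Subtype.ext; simp [coe_ζC]
  | succ q ih => rw [Nat.mul_succ, ζC_add, ih, ζC_self hg, one_mul]

/-- `ζ_a` depends only on `a mod g`. [folklore] -/
theorem ζC_eq_of_mod_eq (hg : 1 ≤ g) {a b : ℕ} (h : a % g = b % g) : ζC g a = ζC g b := by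
  rw [← Nat.div_add_mod a g, ← Nat.div_add_mod b g, ζC_add, ζC_add, ζC_mul_self hg,
    ζC_mul_self hg, h]

/-- **`ρ_j ∘ R_k = R_m` when `m + j ≡ k (mod g)`** (on points of `ℝ³`). [folklore] -/
theorem rot3_Rk (hg : 1 ≤ g) {j k m : ℕ} (h : (m + j) % g = k % g) (p : 𝔼 3) :
    rot3 (ζC g j) (Rk g k p) = Rk g m p := by
  have hζ : ζC g m * ζC g j = ζC g k := by rw [← ζC_add]; exact ζC_eq_of_mod_eq hg h
  have hinv : ζC g j * (ζC g k)⁻¹ = (ζC g m)⁻¹ := by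
    rw [← hζ, mul_inv_rev, mul_inv_cancel_left]
  show lift3 (rot (ζC g j)) (lift3 (rot (ζC g k)⁻¹) p) = lift3 (rot (ζC g m)⁻¹) p
  rw [lift3_lift3]
  congr 1
  funext u
  rw [comp_apply, rot_rot, hinv]

/-- `rot3 (ζ^j)` preserves the flower surface. [folklore] -/
theorem rot3_mem_flowerSurface (hg : 1 ≤ g) (j : ℕ) {p : 𝔼 3} (hp : p ∈ flowerSurface g) :
    rot3 (ζC g j) p ∈ flowerSurface g := by
  rw [flowerSurface_def] at hp ⊢
  show thicken (flower g) (rot3 (ζC g j) p) = level g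
  rw [thicken_flower_rot3 (ζC_pow hg j)]
  exact hp

/-- **The rotation `ρ_j` of the flower surface** as a self-map (restriction of `rot3 (ζ^j)`).
[folklore] -/
def rotS (hg : 1 ≤ g) (j : ℕ) : C(flowerSurface g, flowerSurface g) :=
  ⟨fun z => ⟨rot3 (ζC g j) z.1, rot3_mem_flowerSurface hg j z.2⟩,
    ((rot3 (ζC g j)).continuous.comp continuous_subtype_val).subtype_mk _⟩

/-- `ρ_j` on points. [folklore] -/
@[simp] theorem rotS_apply_coe (hg : 1 ≤ g) (j : ℕ) (z : flowerSurface g) :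
    ((rotS hg j z : flowerSurface g) : 𝔼 3) = rot3 (ζC g j) z.1 := rfl

/-- `ρ_j` fixes the pole. [folklore] -/
theorem rotS_top (hg : 1 ≤ g) (j : ℕ) (h : top g ∈ flowerSurface g) :
    rotS hg j ⟨top g, h⟩ = ⟨top g, h⟩ := by
  apply Subtype.ext
  show rot3 (ζC g j) (top g) = top g
  rw [top, rot3_apply, map_add, map_smul, proj_lift, proj_ez, smul_zero, add_zero, map_zero]
  simp

/-- `mapOfEq` depends only on the map (transport of the base-point proof). [folklore] -/
theorem mapOfEq_congr_map {A Y : Type*} [TopologicalSpace A] [TopologicalSpace Y] {a : A} {y : Y}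
    {f₁ f₂ : C(A, Y)} (e : f₁ = f₂) (h₁ : f₁ a = y) (h₂ : f₂ a = y) (γ : FundamentalGroup A a) :
    FundamentalGroup.mapOfEq f₁ h₁ γ = FundamentalGroup.mapOfEq f₂ h₂ γ := by
  subst e; rfl

/-- **The rotations permute the marking values cyclically**: `(ρ_j)_# (ι_k θ_k(i)) = ι_m θ_m(i)`
whenever `m + j ≡ k (mod g)` — the loop `R_k(γ · loopR i · γ⁻¹)` of the `k`-th slice is carried by
`ρ_j` ONTO the corresponding loop of the `m`-th slice (`ρ_j ∘ R_k = R_m`).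
[cite: FarbMargalit2012, Thm. 8.1 (actions of mapping classes on `π₁`)] -/
theorem mapOfEq_rotS_secSGenClass (hg : 2 ≤ g) {j k m : ℕ} (h : (m + j) % g = k % g)
    (htop : top g ∈ flowerSurface g) (hk : secS g k ⊆ flowerSurface g)
    (hm : secS g m ⊆ flowerSurface g) (i : surfaceGen 1) :
    FundamentalGroup.mapOfEq (rotS (by omega) j) (rotS_top (by omega) j htop)
        (VanKampen.inclHomOfSubset hk (top g) (range_arcK_subset hg k ⟨0, (arcK hg k).source⟩) htop
          (secSGenClass hg k i)) =
      VanKampen.inclHomOfSubset hm (top g) (range_arcK_subset hg m ⟨0, (arcK hg m).source⟩) htop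
        (secSGenClass hg m i) := by
  have hg1 : 1 ≤ g := by omega
  -- everything is a `mapOfEq`
  simp only [secSGenClass, fundamentalGroupEquivOfHomeomorph_apply, VanKampen.inclHomOfSubset]
  rw [← mapOfEq_comp_apply, ← mapOfEq_comp_apply, ← mapOfEq_comp_apply]
  -- the two composite maps `sectorZ → flowerSurface` agree: `ρ_j ∘ R_k = R_m`
  refine mapOfEq_congr_map (ContinuousMap.ext fun p => Subtype.ext ?_) _ _ _
  show rot3 (ζC g j) (Rk g k p.1) = Rk g m p.1
  exact rot3_Rk hg1 h p.1

end FlowerModel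

end Literature.Topology.FourManifolds

end
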